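import Mathlib
import HarnessLib

/-!
# Far-edge descent, kernel XL-A — the z-transform of the width cascade (model level)

Kernel XXXIX-K (`FarEdgeDescentDialWidthCascade`) showed why the β-dial of kernel XXXVIII cannot
square freely under the node floors of XXXIX-G: every product spreads leg mass over wider legs, and the
floors at depth `j` (`(2 − a^{-j})·T_j ≤ β·L`, `T_j` = leg mass at widths `≥ a^j`) then forbid the
squaring.  Memo g59 §2b tracked this with the full width vector and could only do numerics.  This
file replaces the width vector by ONE generating function and shows that everything the cap argument
of kernel XL-B (`FarEdgeDescentChainCap`) needs is an EXACT scalar recursion plus one inequality.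

THE TRANSFORM.  Write the width profile of a node as a real polynomial `p = Σ_{e ≥ 1} M(e)·X^e`
(`M(e) ≥ 0` the leg mass at width `a^e`, no constant term), `L = p(1)` its leg mass, `Q` its anchor.
Under the product `N ⊗ N'` the anchors and profiles combine as
`Q_P = QQ' + β(β−1)LL'`, `p_P = Q·p' + Q'·p + p·p'` (anchor × legs keep their width, legs × legs add
widths: kernel XXXIX-K), so for every real `z` the transform `G(z) = p(z)` obeys the EXACT rule
`G_P(z) = Q·G'(z) + Q'·G(z) + G(z)·G'(z)` (`transform_product`).  In terms of the NARROWNESS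
`V(z) = G(z)/(z·L) ∈ [0, 1]` (`narrowness_le_one`; `V = 1` iff all legs have width `a`, `V(0+) =` the
narrow fraction) and the SHARE `λ = L/(Q + βL)`:
* `r = Q + βL` is multiplicative and `λ_P = λ + λ' − (2β−1)λλ'` (`share_product`);
* `V_P·λ_P = λ'(1−βλ)·V' + λ(1−βλ')·V + z·λλ'·V·V'` (`narrowness_product`) — a convex-type average
  with a bilinear correction, closed in the two scalars `(λ, V)`;
* specialisations: squaring `λ ↦ 2λ − (2β−1)λ²`, `V ↦ (2(1−βλ)V + zλV²)/(2 − (2β−1)λ)`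
  (`narrowness_square`), and a width-`a` base (`V_b = 1`, share `μ = 1/(b+β)`, heavy iff `b ≥ β−1`
  iff `μ ≤ 1/(2β−1)`, `base_share_heavy`) — exactly the clauses of the chain model of XL-B.
THE FLOOR TRANSFER (`eval_ge_pow_mul_low_mass`, `low_mass_of_floor`, `narrowness_floor`): one node
floor at depth `j+2` forces the mass at widths `< a^{j+2}` to be at least `φ·L`,
`φ = 1 − β/(2 − a^{-(j+2)})`, hence `V(z) ≥ z^j·φ` for `z ∈ (0,1]`.  So an admissible squaring of the
dial has `V_sq(z) ≥ V_min := z^j·φ` — the single scalar constraint under which XL-B proves the cap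
`κ ≤ κ_S` along every chain (for `β = 19/10`: `j = 8`, `z = 99/100`, `V_min ≈ 0.0457`; memo g60 §2).

HONEST FRAMING: MODEL level (real polynomials and real numbers; the dictionary node ↦ `(Q, p)` is
memo g58 §1 / XXXIX-K and is not re-derived from tensors here); no `sorry`, no new axioms, no
definitions.  References: Schönhage 1981 [Schonhage1981]; Coppersmith–Winograd 1982
[CoppersmithWinograd1982]; Landsberg–Ottaviani 2015 [LandsbergOttaviani2015] (the floors, via
XXXIX-G `FarEdgeDescentKoszulFloorWide`); kernel XXXIX-K.
-/

noncomputable section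

set_option linter.dupNamespace false

namespace Summit.MatrixMultiplication.MatrixMultiplication.Theorems.FarEdgeDescentWidthTransform

open Polynomial Finset

/-! ## The transform is multiplicative-affine under products -/

/-- **Exact product rule of the z-transform.**  With `p_P = Q·p' + Q'·p + p·p'`,
`p_P(z) = Q·p'(z) + Q'·p(z) + p(z)·p'(z)` for every `z`. -/
theorem transform_product (Q Q' z : ℝ) (p p' : Polynomial ℝ) :
    (C Q * p' + C Q' * p + p * p').eval z = Q * p'.eval z + Q' * p.eval z + p.eval z * p'.eval z := by
  simp [eval_add, eval_mul, eval_C]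

/-- The leg mass is the transform at `z = 1`: `L_P = Q·L' + Q'·L + L·L'`. -/
theorem legmass_product (Q Q' : ℝ) (p p' : Polynomial ℝ) :
    (C Q * p' + C Q' * p + p * p').eval 1 = Q * p'.eval 1 + Q' * p.eval 1 + p.eval 1 * p'.eval 1 :=
  transform_product Q Q' 1 p p'

/-- **Share coordinates.**  Write `r = Q + βL` and `λ = L/r`, i.e. `Q = r(1−βλ)`, `L = rλ`.
Then `r` is multiplicative (`Q_P + β·L_P = r·r'` with `Q_P = QQ' + β(β−1)LL'`) and the share of the
product is `λ_P = λ + λ' − (2β−1)·λ·λ'` (`L_P = r r'·λ_P`). -/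
theorem share_product {β Q Q' L L' r r' lam lam' : ℝ} (hQ : Q = r * (1 - β * lam))
    (hL : L = r * lam) (hQ' : Q' = r' * (1 - β * lam')) (hL' : L' = r' * lam') :
    (Q * Q' + β * (β - 1) * L * L') + β * (Q * L' + Q' * L + L * L') = r * r' ∧
    Q * L' + Q' * L + L * L' = r * r' * (lam + lam' - (2 * β - 1) * lam * lam') := by
  subst hQ hL hQ' hL'
  constructor <;> ring

/-- **Exact product rule of the narrowness.**  If `G = z·L·V`, `G' = z·L'·V'` and
`G_P = Q·G' + Q'·G + G·G'`, then `G_P = z·(Q·L'·V' + Q'·L·V + z·L·L'·V·V')`, and in share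
coordinates `Q·L'·V' + Q'·L·V + z·L·L'·V·V' = r r'·(λ'(1−βλ)·V' + λ(1−βλ')·V + z·λλ'·V·V')`;
dividing by `L_P = r r'·λ_P` (`share_product`): `V_P·λ_P = λ'(1−βλ)V' + λ(1−βλ')V + zλλ'VV'`. -/
theorem narrowness_product {β Q Q' L L' r r' lam lam' V V' z : ℝ} (hQ : Q = r * (1 - β * lam))
    (hL : L = r * lam) (hQ' : Q' = r' * (1 - β * lam')) (hL' : L' = r' * lam') :
    Q * (z * L' * V') + Q' * (z * L * V) + (z * L * V) * (z * L' * V') =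
      z * (Q * L' * V' + Q' * L * V + z * L * L' * V * V') ∧
    Q * L' * V' + Q' * L * V + z * L * L' * V * V' =
      r * r' * (lam' * (1 - β * lam) * V' + lam * (1 - β * lam') * V + z * lam * lam' * V * V') := by
  subst hQ hL hQ' hL'
  constructor <;> ring

/-- Division form of the share rule: with `r, r' ≠ 0` and `λ_P := L_P/(r r')`,
`V_P·L_P = Q L' V' + Q' L V + z L L' V V'` gives `V_P·λ_P = λ'(1−βλ)V' + λ(1−βλ')V + zλλ'VV'`. -/
theorem narrowness_product_share {β Q Q' L L' r r' lam lam' V V' VP z : ℝ} (hr : r ≠ 0)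
    (hr' : r' ≠ 0) (hQ : Q = r * (1 - β * lam)) (hL : L = r * lam)
    (hQ' : Q' = r' * (1 - β * lam')) (hL' : L' = r' * lam')
    (hVP : VP * (Q * L' + Q' * L + L * L') = Q * L' * V' + Q' * L * V + z * L * L' * V * V') :
    VP * (lam + lam' - (2 * β - 1) * lam * lam') =
      lam' * (1 - β * lam) * V' + lam * (1 - β * lam') * V + z * lam * lam' * V * V' := by
  obtain ⟨-, h1⟩ := share_product (β := β) hQ hL hQ' hL'
  obtain ⟨-, h2⟩ := narrowness_product (β := β) (V := V) (V' := V') (z := z) hQ hL hQ' hL'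
  rw [h1, h2] at hVP
  have hrr : r * r' ≠ 0 := mul_ne_zero hr hr'
  have : r * r' * (VP * (lam + lam' - (2 * β - 1) * lam * lam')) =
      r * r' * (lam' * (1 - β * lam) * V' + lam * (1 - β * lam') * V + z * lam * lam' * V * V') := by
    rw [← hVP]; ring
  exact mul_left_cancel₀ hrr this

/-- **Squaring.**  In share coordinates a squaring maps `λ ↦ 2λ − (2β−1)λ²` and
`V ↦ (2(1−βλ)V + zλV²)/(2 − (2β−1)λ)` (the square of `narrowness_product` divided by `λ > 0`). -/
theorem narrowness_square {β lam V z Vsq : ℝ} (hlam : 0 < lam) (hD : 0 < 2 - (2 * β - 1) * lam)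
    (h : Vsq * (lam + lam - (2 * β - 1) * lam * lam) =
      lam * (1 - β * lam) * V + lam * (1 - β * lam) * V + z * lam * lam * V * V) :
    lam + lam - (2 * β - 1) * lam * lam = 2 * lam - (2 * β - 1) * lam ^ 2 ∧
    Vsq = (2 * (1 - β * lam) * V + z * lam * V ^ 2) / (2 - (2 * β - 1) * lam) := by
  refine ⟨by ring, ?_⟩
  rw [eq_div_iff hD.ne']
  have h' : lam * (Vsq * (2 - (2 * β - 1) * lam)) =
      lam * (2 * (1 - β * lam) * V + z * lam * V ^ 2) := by
    have := h; ring_nf; ring_nf at this; linarith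
  exact mul_left_cancel₀ hlam.ne' h'

/-- **Bases.**  A width-`a` base `⟨1,Q_b,1⟩ ⊕ legs` with anchor ratio `b = Q_b/L_b` has share
`μ = 1/(b+β)`, and it is heavy (`b ≥ β − 1`) iff `μ ≤ 1/(2β−1)`, i.e. `(2β−1)μ ≤ 1`. -/
theorem base_share_heavy {β b : ℝ} (hβ : 1 < β) (hb : 0 ≤ b) :
    (0 < 1 / (b + β)) ∧ ((2 * β - 1) * (1 / (b + β)) ≤ 1 ↔ β - 1 ≤ b) := by
  have hpos : 0 < b + β := by linarith
  refine ⟨by positivity, ?_⟩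
  rw [← div_eq_mul_one_div, div_le_one hpos]
  constructor <;> intro h <;> linarith

/-! ## Narrowness from the coefficients: range and the floor transfer -/

/-- A profile with nonnegative coefficients and no constant term has `p(z) ≤ z·p(1)` on `[0,1]`:
the narrowness `V(z) = p(z)/(z·L)` is at most `1`. -/
theorem narrowness_le_one (p : Polynomial ℝ) (hnn : ∀ e, 0 ≤ p.coeff e) (h0 : p.coeff 0 = 0)
    {z : ℝ} (hz0 : 0 ≤ z) (hz1 : z ≤ 1) : p.eval z ≤ z * p.eval 1 := by
  rw [eval_eq_sum_range' (Nat.lt_succ_self p.natDegree) z,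
    eval_eq_sum_range' (Nat.lt_succ_self p.natDegree) 1, mul_sum]
  apply sum_le_sum
  intro i _
  rcases Nat.eq_zero_or_pos i with rfl | hi
  · simp [h0]
  · rw [one_pow, mul_one, mul_comm z]
    apply mul_le_mul_of_nonneg_left _ (hnn i)
    calc z ^ i ≤ z ^ 1 := pow_le_pow_of_le_one hz0 hz1 hi
      _ = z := pow_one z

/-- A profile with nonnegative coefficients is nonnegative on `[0, ∞)`. -/
theorem transform_nonneg (p : Polynomial ℝ) (hnn : ∀ e, 0 ≤ p.coeff e) {z : ℝ} (hz0 : 0 ≤ z) :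
    0 ≤ p.eval z := by
  rw [eval_eq_sum_range' (Nat.lt_succ_self p.natDegree) z]
  exact sum_nonneg fun i _ => mul_nonneg (hnn i) (pow_nonneg hz0 i)

/-- **Low legs dominate the transform from below.**  For `z ∈ [0,1]` and nonnegative coefficients,
`z^n · Σ_{e ≤ n} coeff e ≤ p(z)`. -/
theorem eval_ge_pow_mul_low_mass (p : Polynomial ℝ) (hnn : ∀ e, 0 ≤ p.coeff e) {z : ℝ}
    (hz0 : 0 ≤ z) (hz1 : z ≤ 1) (n : ℕ) :
    z ^ n * ∑ e ∈ range (n + 1), p.coeff e ≤ p.eval z := by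
  have hN : p.natDegree < max (p.natDegree + 1) (n + 1) :=
    lt_of_lt_of_le (Nat.lt_succ_self _) (le_max_left _ _)
  rw [eval_eq_sum_range' hN z, mul_sum]
  calc ∑ e ∈ range (n + 1), z ^ n * p.coeff e
      ≤ ∑ e ∈ range (n + 1), p.coeff e * z ^ e := by
        apply sum_le_sum
        intro e he
        rw [mul_comm]
        exact mul_le_mul_of_nonneg_left
          (pow_le_pow_of_le_one hz0 hz1 (Nat.lt_succ_iff.mp (mem_range.mp he))) (hnn e)
    _ ≤ ∑ e ∈ range (max (p.natDegree + 1) (n + 1)), p.coeff e * z ^ e := by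
        apply sum_le_sum_of_subset_of_nonneg
          (fun e he => mem_range.2 (lt_of_lt_of_le (mem_range.1 he) (le_max_right _ _)))
        intro e _ _
        exact mul_nonneg (hnn e) (pow_nonneg hz0 e)

/-- **A node floor is a lower bound on low mass.**  If the leg mass splits as `S + T = L` (narrow +
wide at the floor's depth) and the floor reads `c·T ≤ β·L` with `c > 0` (`c = 2 − a^{-j}` for the
floors of XXXIX-G), then `S ≥ (1 − β/c)·L`. -/
theorem low_mass_of_floor {β c S T L : ℝ} (hc : 0 < c) (hsplit : S + T = L) (hfloor : c * T ≤ β * L) :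
    (1 - β / c) * L ≤ S := by
  have : β / c * L = β * L / c := by ring
  rw [sub_mul, one_mul, this, sub_le_iff_le_add, ← hsplit, add_le_add_iff_left,
    le_div_iff₀ hc, hsplit]
  linarith

/-- **Floor transfer.**  If the legs of width `< a^{j+2}` carry at least `φ·L` of the leg mass
(`low_mass_of_floor` with the depth-`(j+2)` floor gives `φ = 1 − β/(2 − a^{-(j+2)})`), then the
narrowness satisfies `V(z) ≥ z^j·φ` for `z ∈ (0,1]`.  This is the scalar floor `V_min = z^j·φ`
under which kernel XL-B caps the dial. -/
theorem narrowness_floor (p : Polynomial ℝ) (hnn : ∀ e, 0 ≤ p.coeff e) {z L V φ : ℝ}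
    (hz0 : 0 < z) (hz1 : z ≤ 1) (hL : 0 < L) (hV : V * (z * L) = p.eval z) (j : ℕ)
    (hlow : φ * L ≤ ∑ e ∈ range (j + 2), p.coeff e) :
    z ^ j * φ ≤ V := by
  have h1 := eval_ge_pow_mul_low_mass p hnn hz0.le hz1 (j + 1)
  rw [← hV, pow_succ] at h1
  -- z^j * z * Σ ≤ V * (z * L)  and  φ L ≤ Σ
  have h2 : z ^ j * z * (φ * L) ≤ z ^ j * z * ∑ e ∈ range (j + 1 + 1), p.coeff e :=
    mul_le_mul_of_nonneg_left hlow (by positivity)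
  have h3 : (z ^ j * φ) * (z * L) ≤ V * (z * L) := by nlinarith
  exact le_of_mul_le_mul_right h3 (by positivity)

end Summit.MatrixMultiplication.MatrixMultiplication.Theorems.FarEdgeDescentWidthTransform
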